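import Summits.Ventures.PercRepro.RLSRuleOneLineFiveT1
import Summits.Ventures.PercRepro.RLSPlanesT2_1

/-!
# C-025 at q = 3: `R₃⁺` on the `5`-point plane «`3`-point line + two points» at `t = 2` and at EVERY type
(night-3, gen 4)

* `t = 2` (`ρ(E ∖ G) = p − 2`, `|K| = n + 2`, `ρ(E) ≥ p`): the line does not lie in `cl(E ∖ G)`
  (`not_line_subset_closure_compl_of_rank`), every witness is good; the demand is at most `9` (the independent
  triples) and the pure form `9r₀ + 18r₁ + 9r₂ ≥ 9Φ` (`U2.Planes1.plane5_t2`) closes it;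
* `t ≥ 3`: the demand is `0`.

**`perFlat_oneLineFive_all`**: on `Core M (n + 4)`, `n ≥ 4`, the plane `ℓ ∪ {a, b}` satisfies the per-flat inequality
of `R₃⁺` — `t = 0` by `perFlat_oneLine`, `t = 1` by `perFlat_oneLineFive_t1`, `t = 2` by `perFlat_oneLineFive_t2`.
With `perFlat_three_line_point_all`, `perFlat_twoLines_all` and `perFlat_lineFree`, ALL SIX `𝒯₀` planes are settled
at every type on the core.  Imports `RLSRuleOneLineFiveT1`, the landed table `RLSPlanesT2_1`.  Axioms: standard.
-/

open scoped Matroid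

namespace PercRepro

namespace NightThree

open Finset ThmH PerFlat

variable {α : Type*} [DecidableEq α] {M : Matroid α} [M.Finite]

open scoped Classical in
/-- **`R₃⁺` at `t = 2` on the plane `ℓ ∪ {a, b}`**, every `p = n + 4 ≥ 8`, `ρ(E) ≥ p`. -/
theorem perFlat_oneLineFive_t2 {G ℓ : Finset α} {n : ℕ} (hG : G ∈ flatsQ M 3) (h : OneLine M G ℓ)
    (hGc : G.card = 5) (hn : 4 ≤ n) (hK : M.eRk ((gr M \ G : Finset α) : Set α) = ((n + 2 : ℕ) : ℕ∞))
    (hr : ((n + 4 : ℕ) : ℕ∞) ≤ M.eRank) :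
    phiK (n + 4) 3 * ((UqG M (n + 4) 3 G).card : ℚ) ≤ ∑ S ∈ Yq M (n + 4) 3, wPlus M G S := by
  obtain ⟨K, hKsub, hKind, hKcard⟩ := exists_indep_compl_card G (p := n + 2) (le_of_eq hK.symm)
  have hKG : Disjoint K G := by
    rw [Finset.disjoint_left]
    intro x hxK hxG
    have := hKsub hxK
    rw [Finset.mem_sdiff] at this
    exact this.2 hxG
  obtain ⟨hmem3, h𝔅rank, hd34, hd5, hc3, hc4⟩ := oneLineFive_family hG h hGc
  obtain ⟨hℓG, hℓc, hℓr, hone⟩ := h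
  have h' : OneLine M G ℓ := ⟨hℓG, hℓc, hℓr, hone⟩
  have hGE : G ⊆ gr M := (mem_flatsQ.1 hG).1
  have hlt : M.eRk ((gr M \ G : Finset α) : Set α) + 1 < M.eRank := by
    rw [hK]
    calc ((n + 2 : ℕ) : ℕ∞) + 1 = ((n + 3 : ℕ) : ℕ∞) := by push_cast; ring
      _ < ((n + 4 : ℕ) : ℕ∞) := by exact_mod_cast (by omega : n + 3 < n + 4)
      _ ≤ M.eRank := hr
  -- the line is not inside `cl(E ∖ G)`: every witness is good
  have hnot : ¬ (ℓ : Set α) ⊆ M.closure ((gr M \ G : Finset α) : Set α) := by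
    obtain ⟨g, hg⟩ : ∃ g, g ∈ G \ ℓ := by
      apply Finset.card_pos.1
      rw [Finset.card_sdiff_of_subset hℓG, hGc, hℓc]
      norm_num
    rw [Finset.mem_sdiff] at hg
    apply not_line_subset_closure_compl_of_rank hG hℓG hg.1 _ hlt
    exact eRk_eq_three_of_four_oneLine hG h' (Finset.insert_subset hg.1 hℓG)
      (by rw [Finset.card_insert_of_notMem hg.2, hℓc])
  have hgood : ∀ X, GoodWitness M ℓ K X := by
    intro X C hC
    have hℓE : (ℓ : Set α) ⊆ M.E := by
      rw [← coe_gr M]; exact Finset.coe_subset.2 (hℓG.trans hGE)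
    rw [coplanarTriples_eq_empty_of_not_subset hℓE hKsub hKind hnot] at hC
    exact absurd hC (Finset.notMem_empty C)
  -- the demand: at most `9`
  have hdem : ((UqG M (n + 4) 3 G).card : ℚ) ≤ 9 := by
    have := Finset.card_le_card (UqG_subset_of_oneLineFive_t2 h' hGc hK)
    rw [hc3] at this
    exact_mod_cast this
  -- the crude shares
  set f : Finset α → Finset α → ℚ := fun B X =>
    ((B.card.choose 3 - (if ℓ ⊆ B then 1 else 0) : ℕ) : ℚ) / (((B.card + X.card).choose 3 : ℕ) : ℚ) with hf
  have hsup := supply_ge_of_family hG h𝔅rank hKsub hKind n f (fun B hB X hX => by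
    obtain ⟨hXK, _, _⟩ := mem_witnessFamily hX
    have hXind : M.Indep (X : Set α) := hKind.subset (Finset.coe_subset.2 hXK)
    have hXG : Disjoint X G := Finset.disjoint_of_subset_left hXK hKG
    have hBG := (h𝔅rank B hB).1
    have hB5 : B.card ≤ 5 := by rw [← hGc]; exact Finset.card_le_card hBG
    have hw := wPlus_ge_of_oneLine hG h' hBG hXind hXG hXK (Or.inr (hgood X))
    rw [if_pos hB5] at hw
    exact hw)
  -- the sums (`|K| = n + 2`)
  have hw0 : ∑ X ∈ witnessFamily K n, 1 / (((3 + X.card).choose 3 : ℕ) : ℚ) = U2.r0Sum n := by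
    rw [sum_witnessFamily K n (fun x => 1 / (((3 + x).choose 3 : ℕ) : ℚ)), hKcard]
    unfold U2.r0Sum
    apply Finset.sum_congr rfl
    intro i _
    rw [show 3 + (i + 1) = i + 4 by omega]
    ring
  have hw1 : ∀ c : ℚ, ∑ X ∈ witnessFamily K n, c / (((4 + X.card).choose 3 : ℕ) : ℚ) = c * U2.r1Sum n := by
    intro c
    rw [sum_witnessFamily K n (fun x => c / (((4 + x).choose 3 : ℕ) : ℚ)), hKcard]
    unfold U2.r1Sum
    rw [Finset.mul_sum]
    apply Finset.sum_congr rfl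
    intro i _
    rw [show 4 + (i + 1) = i + 5 by omega]
    ring
  have hw2 : ∑ X ∈ witnessFamily K n, 9 / (((5 + X.card).choose 3 : ℕ) : ℚ) = 9 * U2.r2Sum n := by
    rw [sum_witnessFamily K n (fun x => 9 / (((5 + x).choose 3 : ℕ) : ℚ)), hKcard]
    unfold U2.r2Sum
    rw [Finset.mul_sum]
    apply Finset.sum_congr rfl
    intro i _
    rw [show 5 + (i + 1) = i + 6 by omega]
    ring
  have h3 : ∑ B ∈ (G.powersetCard 3).erase ℓ, ∑ X ∈ witnessFamily K n, f B X = 9 * U2.r0Sum n := by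
    have hval : ∀ B ∈ (G.powersetCard 3).erase ℓ, ∑ X ∈ witnessFamily K n, f B X = U2.r0Sum n := by
      intro B hB
      obtain ⟨_, hBc, hl, _⟩ := hmem3 B hB
      have : ∀ X ∈ witnessFamily K n, f B X = 1 / (((3 + X.card).choose 3 : ℕ) : ℚ) := by
        intro X _
        rw [hf]
        dsimp only
        rw [hBc]
        simp only [if_neg hl, Nat.choose_self, Nat.sub_zero, Nat.cast_one]
      rw [Finset.sum_congr rfl this, hw0]
    rw [Finset.sum_congr rfl hval, Finset.sum_const, hc3, nsmul_eq_mul]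
    norm_num
  have h4 : ∑ B ∈ G.powersetCard 4, ∑ X ∈ witnessFamily K n, f B X =
      2 * (3 * U2.r1Sum n) + 3 * (4 * U2.r1Sum n) := by
    apply sum_powersetCard_four_oneLine hℓG hℓc hGc
    · intro B hB hl
      have hBc := (Finset.mem_powersetCard.1 hB).2
      have hval : ∀ X ∈ witnessFamily K n, f B X = 3 / (((4 + X.card).choose 3 : ℕ) : ℚ) := by
        intro X _
        rw [hf]
        dsimp only
        rw [hBc, show Nat.choose 4 3 = 4 by norm_num [Nat.choose]]
        simp only [if_pos hl]
        norm_num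
      rw [Finset.sum_congr rfl hval, hw1]
    · intro B hB hl
      have hBc := (Finset.mem_powersetCard.1 hB).2
      have hval : ∀ X ∈ witnessFamily K n, f B X = 4 / (((4 + X.card).choose 3 : ℕ) : ℚ) := by
        intro X _
        rw [hf]
        dsimp only
        rw [hBc, show Nat.choose 4 3 = 4 by norm_num [Nat.choose]]
        simp only [if_neg hl, Nat.sub_zero]
        norm_num
      rw [Finset.sum_congr rfl hval, hw1]
  have h5 : ∑ X ∈ witnessFamily K n, f G X = 9 * U2.r2Sum n := by
    have hval : ∀ X ∈ witnessFamily K n, f G X = 9 / (((5 + X.card).choose 3 : ℕ) : ℚ) := by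
      intro X _
      rw [hf]
      dsimp only
      rw [hGc, show Nat.choose 5 3 = 10 by norm_num [Nat.choose]]
      simp only [if_pos hℓG]
      norm_num
    rw [Finset.sum_congr rfl hval, hw2]
  have hphi : phiK (n + 4) 3 = ∑ i ∈ range n, ((n + 4).choose (i + 1) : ℚ) / ((i + 4).choose 3 : ℚ) := by
    unfold phiK
    rw [phiW_eq_phiK_form n]
    rfl
  have hcert := U2.Planes1.plane5_t2 n hn
  rw [← hphi] at hcert
  calc phiK (n + 4) 3 * ((UqG M (n + 4) 3 G).card : ℚ)
      ≤ phiK (n + 4) 3 * 9 := mul_le_mul_of_nonneg_left hdem (phiK_nonneg _ _)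
    _ ≤ 9 * U2.r0Sum n + 18 * U2.r1Sum n + 9 * U2.r2Sum n := hcert
    _ = ∑ B ∈ (G.powersetCard 3).erase ℓ ∪ G.powersetCard 4 ∪ {G}, ∑ X ∈ witnessFamily K n, f B X := by
        rw [Finset.sum_union hd5, Finset.sum_union hd34, Finset.sum_singleton, h3, h4, h5]
        ring
    _ ≤ ∑ S ∈ Yq M (n + 4) 3, wPlus M G S := hsup

open scoped Classical in
/-- **`R₃⁺` on the plane `ℓ ∪ {a, b}` at EVERY type**, every `p = n + 4 ≥ 8`, on a core matroid: `t = 0` by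
`perFlat_oneLine`, `t = 1` by `perFlat_oneLineFive_t1`, `t = 2` by `perFlat_oneLineFive_t2`, `t ≥ 3` by the
vanishing demand. -/
theorem perFlat_oneLineFive_all {G ℓ : Finset α} {n : ℕ} (hc : Core M (n + 4)) (hG : G ∈ flatsQ M 3)
    (h : OneLine M G ℓ) (hGc : G.card = 5) (hn : 4 ≤ n) :
    phiK (n + 4) 3 * ((UqG M (n + 4) 3 G).card : ℚ) ≤ ∑ S ∈ Yq M (n + 4) 3, wPlus M G S := by
  obtain ⟨e, he, _⟩ := eRk_eq_nat M (gr M \ G)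
  rcases le_or_gt (n + 4) e with h0 | h0
  · exact perFlat_oneLine hG h hn (by rw [he]; exact_mod_cast h0)
  rcases Nat.lt_or_ge e (n + 2) with h3 | h2
  · -- `t ≥ 3`: no demand
    have hdem := card_UqG_le_of_eRk_compl G (p := n + 4) (t := 3) he (by omega)
    have h0' : demandCount G.card 3 = 0 := by
      rw [hGc]
      unfold demandCount
      norm_num [Finset.sum_range_succ]
    rw [h0'] at hdem
    have hU : ((UqG M (n + 4) 3 G).card : ℚ) = 0 := le_antisymm hdem (by positivity)
    rw [hU, mul_zero]
    exact Finset.sum_nonneg (fun S _ => wPlus_nonneg M G S)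
  rcases Nat.lt_or_ge e (n + 3) with h2' | h1
  · have he' : e = n + 2 := by omega
    exact perFlat_oneLineFive_t2 hG h hGc hn (by rw [he, he']) (by rw [hc.2.1])
  · have he' : e = n + 3 := by omega
    exact perFlat_oneLineFive_t1 hG h hGc hn (by rw [he, he'])

end NightThree

end PercRepro
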